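import Literature.NumberTheory.LFunctions.FeketePolyaKernelPackedArithmetic
import HarnessLib

/-!
# Packed digit statistics and the block-mask extraction of negative parts

Generic Kronecker-substitution lemmas used by the packed truncation certificates (Chua's ALGO 1 evaluated on packed sign digits):
digit sums by one reduction modulo `2^b − 1`, the ramp vector `Σ t·2^{bt}`, masking by a `0/1` vector, affine combinations of
prefix-count vectors, and the extraction of `Σ_t max(0, −p_t)` from the packed vector of `2^{b−1} + p_t` (`|p_t| < 2^{Bk}`): clearing
the top bit of the non-negative digits leaves the block bit `2^{Bk}` set exactly on the negative digits, whose low blocks are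
`2^{Bk} − |p_t|`. [cite: GathenGerhard2013ModernComputerAlgebra, §8.4 (Kronecker substitution)] [cite: Chua2005RealZeros, §2.2 ALGO 1]
-/

namespace Literature.NumberTheory.LFunctions

namespace LTruncationPacked

open Finset FeketePolyaKernel Literature.Analysis.Convolution

/-! ### Digit sums, ramps, masks -/

/-- Digit sum of a packed vector by one reduction modulo `2^b − 1`. [cite: GathenGerhard2013ModernComputerAlgebra, §8.4 (Kronecker substitution)] -/
def dsum (b V : ℕ) : ℕ := V % ((1 <<< b) - 1)

/-- `rampV b L R = Σ_{t<L} t·2^{bt}` computed from `R = onesV b L` as `(R·R mod 2^{bL}) − R`.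
[cite: GathenGerhard2013ModernComputerAlgebra, §8.4 (Kronecker substitution)] -/
def rampV (b L R : ℕ) : ℕ := ((R * R) &&& ((1 <<< (b * L)) - 1)) - R

/-- `dsum` is the digit sum when it is `< 2^b − 1`. [cite: GathenGerhard2013ModernComputerAlgebra, §8.4 (Kronecker substitution)] -/
theorem dsum_kpack {b L : ℕ} {f : ℕ → ℕ} (h : ∑ j ∈ range L, f j < 2 ^ b - 1) :
    dsum b (kpack b L f) = ∑ j ∈ range L, f j := by
  rw [dsum, Nat.one_shiftLeft, kpack_mod_eq_sum h]

/-- The ramp vector is the packed vector of `t ↦ t` (`L < 2^b`, `b ≥ 1`). [cite: GathenGerhard2013ModernComputerAlgebra, §8.4 (Kronecker substitution)] -/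
theorem rampV_eq {b L : ℕ} (hb : 1 ≤ b) (hL : L < 2 ^ b) : rampV b L (onesV b L) = kpack b L fun t => t := by
  have h1 := kpack_mul_onesV_low hb (L := L) (d := fun _ => 1) (by simpa using hL)
  rw [rampV, Nat.one_shiftLeft]
  conv_lhs => rw [show onesV b L * onesV b L = kpack b L (fun _ => 1) * onesV b L by rw [onesV_eq_kpack hb]]
  rw [h1, onesV_eq_kpack hb, kpack_tsub (fun j _ => ?_)]
  · refine kpack_congr fun j _ => ?_
    simp [psumF]
  · simp [psumF]

/-- Masking by a `0/1` vector: `kpack f &&& (kpack ind · (2^b − 1)) = kpack (f · ind)`.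
[cite: GathenGerhard2013ModernComputerAlgebra, §8.4 (Kronecker substitution)] -/
theorem kpack_land_indMask {b L : ℕ} (hb : 1 ≤ b) {f ind : ℕ → ℕ} (hf : ∀ j < L, f j < 2 ^ b)
    (hind : ∀ j < L, ind j ≤ 1) :
    kpack b L f &&& (kpack b L ind * (2 ^ b - 1)) = kpack b L fun j => f j * ind j := by
  have h1 : (1 : ℕ) ≤ 2 ^ b := Nat.one_le_two_pow
  rw [mul_comm, kpack_smul]
  rw [kpack_land (by omega) hf (fun j hj => ?_)]
  · refine kpack_congr fun j hj => ?_
    rcases Nat.le_one_iff_eq_zero_or_eq_one.1 (hind j hj) with h | h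
    · simp [h]
    · simp only [h, mul_one, Nat.and_two_pow_sub_one_eq_mod, Nat.mod_eq_of_lt (hf j hj)]
  · rcases Nat.le_one_iff_eq_zero_or_eq_one.1 (hind j hj) with h | h
    · simp [h]
    · simp only [h, mul_one]; omega

/-- Affine combination of packed vectors without borrows: `A·1 + w·kpack cp − c·kpack cm = kpack (A + w cp − c cm)`
when `c·cm_j ≤ A + w·cp_j` slotwise. [cite: GathenGerhard2013ModernComputerAlgebra, §8.4 (Kronecker substitution)] -/
theorem affine_kpack {b L A w c : ℕ} (hb : 1 ≤ b) {cp cm : ℕ → ℕ} (hle : ∀ j < L, c * cm j ≤ A + w * cp j) :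
    A * onesV b L + w * kpack b L cp - c * kpack b L cm = kpack b L fun j => A + w * cp j - c * cm j := by
  rw [onesV_eq_kpack hb, kpack_smul, kpack_smul, kpack_smul, kpack_add_kpack]
  simp only [mul_one]
  exact kpack_tsub hle

/-! ### Bits of the shifted digits -/

/-- `u &&& 2^k` is `2^k` or `0` according to bit `k` of `u`. [folklore] -/
private theorem land_two_pow (u k : ℕ) : u &&& 2 ^ k = if u.testBit k then 2 ^ k else 0 := by
  refine Nat.eq_of_testBit_eq fun i => ?_
  rw [Nat.testBit_and, Nat.testBit_two_pow]
  by_cases hik : k = i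
  · subst hik
    by_cases h : u.testBit k
    · simp [h, Nat.testBit_two_pow_self]
    · simp [h]
  · by_cases h : u.testBit k
    · simp [h, hik]
    · simp [h, hik]

/-- Top bit of a digit `v < 2^b`: `v &&& 2^{b−1} = 2^{b−1}` iff `2^{b−1} ≤ v`, else `0`. [folklore] -/
private theorem land_top {b v : ℕ} (hb : 1 ≤ b) (hv : v < 2 ^ b) :
    v &&& 2 ^ (b - 1) = if 2 ^ (b - 1) ≤ v then 2 ^ (b - 1) else 0 := by
  rw [land_two_pow]
  by_cases h : 2 ^ (b - 1) ≤ v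
  · rw [if_pos h]
    have : v.testBit (b - 1) = true := by
      by_contra hne
      have hlt : v < 2 ^ (b - 1) := Nat.lt_pow_two_of_testBit v fun j hj => by
        rcases Nat.lt_or_ge j b with hjb | hjb
        · have : j = b - 1 := by omega
          subst this; simpa using hne
        · exact Nat.testBit_lt_two_pow (lt_of_lt_of_le hv (Nat.pow_le_pow_right (by norm_num) hjb))
      omega
    rw [if_pos this]
  · rw [if_neg h]
    have : v.testBit (b - 1) = false := by
      by_contra hne
      have := Nat.ge_two_pow_of_testBit (by simpa using hne : v.testBit (b - 1) = true)
      exact h this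
    simp [this]

/-- A negative digit `2^{b−1} − x` (`1 ≤ x ≤ 2^{Bk}`, `Bk < b − 1`): its block bit `Bk` is set and its low block is `2^{Bk} − x`. [folklore] -/
private theorem neg_digit_bits {b Bk x : ℕ} (hBk : Bk < b - 1) (hx1 : 1 ≤ x) (hx : x ≤ 2 ^ Bk) :
    (2 ^ (b - 1) - x).testBit Bk = true ∧ (2 ^ (b - 1) - x) % 2 ^ Bk = 2 ^ Bk - x := by
  obtain ⟨y, rfl⟩ : ∃ y, x = y + 1 := ⟨x - 1, by omega⟩
  have hyBk : y < 2 ^ Bk := by omega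
  have hyb : y < 2 ^ (b - 1) := lt_of_lt_of_le hyBk (Nat.pow_le_pow_right (by norm_num) hBk.le)
  constructor
  · rw [Nat.testBit_two_pow_sub_succ hyb, Nat.testBit_lt_two_pow hyBk]; simp [hBk]
  · refine Nat.eq_of_testBit_eq fun i => ?_
    rw [Nat.testBit_mod_two_pow, Nat.testBit_two_pow_sub_succ hyb,
      show 2 ^ Bk - (y + 1) = 2 ^ Bk - (y + 1) from rfl, Nat.testBit_two_pow_sub_succ hyBk]
    by_cases hi : i < Bk
    · simp [hi, show i < b - 1 by omega]
    · simp [hi]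

/-- A non-negative digit `y < 2^{Bk}`: block bit `Bk` clear, low block `y`. [folklore] -/
private theorem pos_digit_bits {Bk y : ℕ} (hy : y < 2 ^ Bk) : y.testBit Bk = false ∧ y % 2 ^ Bk = y :=
  ⟨Nat.testBit_lt_two_pow hy, Nat.mod_eq_of_lt hy⟩

/-- Masking by a `0/1` vector with a `k`-bit block mask (`k ≤ b`): `kpack f &&& (kpack ind · (2^k − 1)) = kpack ((f mod 2^k) · ind)`.
[cite: GathenGerhard2013ModernComputerAlgebra, §8.4 (Kronecker substitution)] -/
theorem kpack_land_indMask' {b k L : ℕ} (hb : 1 ≤ b) (hk : k ≤ b) {f ind : ℕ → ℕ} (hf : ∀ j < L, f j < 2 ^ b)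
    (hind : ∀ j < L, ind j ≤ 1) :
    kpack b L f &&& (kpack b L ind * (2 ^ k - 1)) = kpack b L fun j => f j % 2 ^ k * ind j := by
  have hkb : 2 ^ k ≤ 2 ^ b := Nat.pow_le_pow_right (by norm_num) hk
  have h1 : (1 : ℕ) ≤ 2 ^ k := Nat.one_le_two_pow
  rw [mul_comm, kpack_smul]
  rw [kpack_land (by omega) hf (fun j hj => ?_)]
  · refine kpack_congr fun j hj => ?_
    rcases Nat.le_one_iff_eq_zero_or_eq_one.1 (hind j hj) with h | h
    · simp [h]
    · simp only [h, mul_one, Nat.and_two_pow_sub_one_eq_mod]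
  · rcases Nat.le_one_iff_eq_zero_or_eq_one.1 (hind j hj) with h | h
    · simp [h]
    · simp only [h, mul_one]; omega

/-! ### Extraction of the negative parts -/

section NegSum

variable {b Bk L : ℕ} {p : ℕ → ℤ}

/-- The offset digits `v_j = 2^{b−1} + p_j`. [cite: Chua2005RealZeros, §2.2 ALGO 1] -/
def offDigit (b : ℕ) (p : ℕ → ℤ) (j : ℕ) : ℕ := ((2 ^ (b - 1) : ℕ) + p j).toNat

/-- The digits after clearing the top bit of the non-negative ones: `p_j` if `p_j ≥ 0`, else `2^{b−1} − |p_j|`. [cite: Chua2005RealZeros, §2.2 ALGO 1] -/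
def lowDigit (b : ℕ) (p : ℕ → ℤ) (j : ℕ) : ℕ := if 0 ≤ p j then (p j).toNat else 2 ^ (b - 1) - (-p j).toNat

/-- Indicator of the negative positions. [cite: Chua2005RealZeros, §2.2 ALGO 1] -/
def negInd (p : ℕ → ℤ) (j : ℕ) : ℕ := if p j < 0 then 1 else 0

/-- The offset digit as an integer. [folklore] -/
private theorem offDigit_cast (hBk : Bk + 2 ≤ b) (hp : ∀ j < L, (p j).natAbs < 2 ^ Bk) {j : ℕ} (hj : j < L) :
    ((offDigit b p j : ℕ) : ℤ) = (2 ^ (b - 1) : ℕ) + p j := by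
  have h1 := hp j hj
  have hpow : 2 ^ Bk ≤ 2 ^ (b - 1) := Nat.pow_le_pow_right (by norm_num) (by omega)
  rw [offDigit]
  have h2 : ((p j).natAbs : ℤ) < ((2 ^ Bk : ℕ) : ℤ) := by exact_mod_cast h1
  have h3 : ((2 ^ Bk : ℕ) : ℤ) ≤ ((2 ^ (b - 1) : ℕ) : ℤ) := by exact_mod_cast hpow
  exact Int.toNat_of_nonneg (by omega)

/-- The offset digits are `< 2^b`. [folklore] -/
private theorem offDigit_lt (hBk : Bk + 2 ≤ b) (hp : ∀ j < L, (p j).natAbs < 2 ^ Bk) {j : ℕ} (hj : j < L) :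
    offDigit b p j < 2 ^ b := by
  have h := offDigit_cast hBk hp hj
  have h1 := hp j hj
  have hpow : 2 ^ Bk ≤ 2 ^ (b - 1) := Nat.pow_le_pow_right (by norm_num) (by omega)
  have hb2 : 2 ^ b = 2 * 2 ^ (b - 1) := by rw [← pow_succ']; congr 1; omega
  have h2 : ((p j).natAbs : ℤ) < ((2 ^ Bk : ℕ) : ℤ) := by exact_mod_cast h1
  have h3 : ((2 ^ Bk : ℕ) : ℤ) ≤ ((2 ^ (b - 1) : ℕ) : ℤ) := by exact_mod_cast hpow
  have h4 : ((2 ^ b : ℕ) : ℤ) = 2 * ((2 ^ (b - 1) : ℕ) : ℤ) := by exact_mod_cast hb2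
  have : ((offDigit b p j : ℕ) : ℤ) < ((2 ^ b : ℕ) : ℤ) := by rw [h, h4]; omega
  exact_mod_cast this

/-- Clearing the top bits: `V − (V &&& 2^{b−1}·1) = kpack lowDigit`. [cite: Chua2005RealZeros, §2.2 ALGO 1] -/
theorem sub_land_top_eq (hBk : Bk + 2 ≤ b) (hp : ∀ j < L, (p j).natAbs < 2 ^ Bk) :
    kpack b L (offDigit b p) - (kpack b L (offDigit b p) &&& (2 ^ (b - 1) * onesV b L)) =
      kpack b L (lowDigit b p) := by
  have hb : 1 ≤ b := by omega
  have hH : 2 ^ (b - 1) < 2 ^ b := Nat.pow_lt_pow_right (by norm_num) (by omega)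
  rw [onesV_eq_kpack hb, kpack_smul, mul_one,
    kpack_land (by omega) (fun j hj => offDigit_lt hBk hp hj) (fun j _ => hH),
    kpack_tsub (fun j hj => ?_)]
  · refine kpack_congr fun j hj => ?_
    have hc := offDigit_cast hBk hp hj
    have h1 := hp j hj
    have hpow : 2 ^ Bk ≤ 2 ^ (b - 1) := Nat.pow_le_pow_right (by norm_num) (by omega)
    rw [land_top hb (offDigit_lt hBk hp hj), lowDigit]
    by_cases h0 : 0 ≤ p j
    · have hge : 2 ^ (b - 1) ≤ offDigit b p j := by zify; rw [hc]; push_cast; linarith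
      rw [if_pos hge, if_pos h0]; zify [hge]; rw [hc, Int.toNat_of_nonneg h0]; push_cast; ring
    · have hlt : ¬ 2 ^ (b - 1) ≤ offDigit b p j := by zify; rw [hc]; push_cast; linarith
      have hle : (-p j).toNat ≤ 2 ^ (b - 1) := by
        have : ((-p j).toNat : ℤ) = -p j := Int.toNat_of_nonneg (by linarith)
        zify; rw [this]
        have : -(p j) ≤ (p j).natAbs := by omega
        have h2 : ((p j).natAbs : ℤ) < 2 ^ Bk := by exact_mod_cast h1
        have h3 : ((2 ^ Bk : ℕ) : ℤ) ≤ ((2 ^ (b - 1) : ℕ) : ℤ) := by exact_mod_cast hpow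
        push_cast at h3; linarith
      rw [if_neg hlt, if_neg h0, Nat.sub_zero]; zify [hle]; rw [hc, Int.toNat_of_nonneg (by linarith)]; push_cast; ring
  · rw [land_top hb (offDigit_lt hBk hp hj)]
    split_ifs with h
    · exact h
    · exact Nat.zero_le _

/-- The low digits are `< 2^b`. [folklore] -/
private theorem lowDigit_lt (hBk : Bk + 2 ≤ b) (hp : ∀ j < L, (p j).natAbs < 2 ^ Bk) {j : ℕ} (hj : j < L) :
    lowDigit b p j < 2 ^ b := by
  have h1 := hp j hj
  have hH : 2 ^ (b - 1) < 2 ^ b := Nat.pow_lt_pow_right (by norm_num) (by omega)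
  have hpow : 2 ^ Bk ≤ 2 ^ (b - 1) := Nat.pow_le_pow_right (by norm_num) (by omega)
  rw [lowDigit]; split_ifs with h
  · have h' : (p j).toNat = (p j).natAbs := (by omega)
    omega
  · omega

/-- Bits of the low digits: block bit `Bk` set exactly on the negative positions; low block `2^{Bk} − |p_j|` there, `p_j` elsewhere. [folklore] -/
private theorem lowDigit_bits (hBk : Bk + 2 ≤ b) (hp : ∀ j < L, (p j).natAbs < 2 ^ Bk) {j : ℕ} (hj : j < L) :
    (lowDigit b p j).testBit Bk = decide (p j < 0) ∧
      (lowDigit b p j) % 2 ^ Bk = if p j < 0 then 2 ^ Bk - (-p j).toNat else (p j).toNat := by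
  have h1 := hp j hj
  rw [lowDigit]
  by_cases h : 0 ≤ p j
  · have hy : (p j).toNat < 2 ^ Bk := by have h' : (p j).toNat = (p j).natAbs := (by omega); omega
    obtain ⟨hb1, hb2⟩ := pos_digit_bits hy
    simp only [if_pos h, hb1, hb2, show ¬ p j < 0 from not_lt.2 h, decide_false, if_false, and_self]
  · have hx1 : 1 ≤ (-p j).toNat := by omega
    have hx : (-p j).toNat ≤ 2 ^ Bk := by have h' : (-p j).toNat = (p j).natAbs := (by omega); omega
    obtain ⟨hb1, hb2⟩ := neg_digit_bits (b := b) (by omega) hx1 hx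
    simp only [if_neg h, hb1, hb2, show p j < 0 from lt_of_not_ge h, decide_true, if_true, and_self]

/-- The block bits form the indicator of the negative positions: `(U &&& 2^{Bk}·1) >>> Bk = kpack negInd`. [cite: Chua2005RealZeros, §2.2 ALGO 1] -/
theorem negInd_eq (hBk : Bk + 2 ≤ b) (hp : ∀ j < L, (p j).natAbs < 2 ^ Bk) :
    (kpack b L (lowDigit b p) &&& (2 ^ Bk * onesV b L)) >>> Bk = kpack b L (negInd p) := by
  have hb : 1 ≤ b := by omega
  have hBb : 2 ^ Bk < 2 ^ b := Nat.pow_lt_pow_right (by norm_num) (by omega)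
  rw [onesV_eq_kpack hb, kpack_smul, mul_one,
    kpack_land (by omega) (fun j hj => lowDigit_lt hBk hp hj) (fun j _ => hBb)]
  have : kpack b L (fun j => lowDigit b p j &&& 2 ^ Bk) = 2 ^ Bk * kpack b L (negInd p) := by
    rw [kpack_smul]
    refine kpack_congr fun j hj => ?_
    rw [land_two_pow, (lowDigit_bits hBk hp hj).1, negInd]
    by_cases h : p j < 0
    · simp [h]
    · simp [h]
  rw [this, Nat.shiftRight_eq_div_pow, Nat.mul_div_cancel_left _ (by positivity)]

/-- The masked low blocks: `U &&& (kpack negInd · (2^{Bk} − 1)) = kpack (negInd · (2^{Bk} − |p|))`. [cite: Chua2005RealZeros, §2.2 ALGO 1] -/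
theorem lowBlocks_eq (hBk : Bk + 2 ≤ b) (hp : ∀ j < L, (p j).natAbs < 2 ^ Bk) :
    kpack b L (lowDigit b p) &&& (kpack b L (negInd p) * (2 ^ Bk - 1)) =
      kpack b L fun j => negInd p j * (2 ^ Bk - (-p j).toNat) := by
  have hb : 1 ≤ b := by omega
  rw [kpack_land_indMask' hb (by omega) (fun j hj => lowDigit_lt hBk hp hj) (fun j _ => by
    rw [negInd]; split_ifs <;> simp)]
  refine kpack_congr fun j hj => ?_
  rw [(lowDigit_bits hBk hp hj).2, negInd]
  by_cases h : p j < 0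
  · simp [h]
  · simp [h]

/-- **The block-mask extraction of the negative parts.** With `V = kpack (2^{b−1} + p_j)` (`|p_j| < 2^{Bk}`, `Bk + 2 ≤ b`,
`L·2^{Bk} < 2^b − 1`), `U = V − (V &&& 2^{b−1}·1)`, `NegI = (U &&& 2^{Bk}·1) >>> Bk`, `LoN = U &&& (NegI·(2^{Bk} − 1))`:
`dsum(NegI)·2^{Bk} − dsum(LoN) = Σ_j max(0, −p_j)`. [cite: Chua2005RealZeros, §2.2 ALGO 1] -/
theorem negsum_eq (hcap : L * 2 ^ Bk < 2 ^ b - 1) (hp : ∀ j < L, (p j).natAbs < 2 ^ Bk) :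
    (dsum b (kpack b L (negInd p)) <<< Bk) - dsum b (kpack b L fun j => negInd p j * (2 ^ Bk - (-p j).toNat)) =
      ∑ j ∈ range L, (-p j).toNat := by
  have h1Bk : 1 ≤ 2 ^ Bk := Nat.one_le_two_pow
  have hind1 : ∀ j, negInd p j ≤ 1 := fun j => by rw [negInd]; split_ifs <;> simp
  have hsum1 : ∑ j ∈ range L, negInd p j < 2 ^ b - 1 := by
    calc ∑ j ∈ range L, negInd p j ≤ ∑ _j ∈ range L, 1 := Finset.sum_le_sum fun j _ => hind1 j
      _ = L := by simp
      _ ≤ L * 2 ^ Bk := Nat.le_mul_of_pos_right L h1Bk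
      _ < 2 ^ b - 1 := hcap
  have hsum2 : ∑ j ∈ range L, negInd p j * (2 ^ Bk - (-p j).toNat) < 2 ^ b - 1 := by
    calc ∑ j ∈ range L, negInd p j * (2 ^ Bk - (-p j).toNat) ≤ ∑ _j ∈ range L, 2 ^ Bk :=
          Finset.sum_le_sum fun j _ => by
            calc negInd p j * (2 ^ Bk - (-p j).toNat) ≤ 1 * 2 ^ Bk :=
                  Nat.mul_le_mul (hind1 j) (Nat.sub_le _ _)
              _ = 2 ^ Bk := one_mul _
      _ = L * 2 ^ Bk := by simp
      _ < 2 ^ b - 1 := hcap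
  rw [dsum_kpack hsum1, dsum_kpack hsum2, Nat.shiftLeft_eq, Finset.sum_mul]
  have hkey : ∀ j ∈ range L, negInd p j * 2 ^ Bk = negInd p j * (2 ^ Bk - (-p j).toNat) + (-p j).toNat := by
    intro j hj
    have hjL : j < L := Finset.mem_range.1 hj
    have h1 := hp j hjL
    rw [negInd]
    by_cases h : p j < 0
    · have hx : (-p j).toNat ≤ 2 ^ Bk := by have h' : (-p j).toNat = (p j).natAbs := (by omega); omega
      rw [if_pos h]; omega
    · have : (-p j).toNat = 0 := by rw [Int.toNat_eq_zero]; linarith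
      rw [if_neg h, this]; simp
  rw [Finset.sum_congr rfl hkey, Finset.sum_add_distrib, Nat.add_sub_cancel_left]

end NegSum

end LTruncationPacked

end Literature.NumberTheory.LFunctions
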